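import Literature.Probability.RandomPlanarGeometry.SAWWordBridges
import Literature.Probability.RandomPlanarGeometry.SAWBridgeUpperBound
import Mathlib.Analysis.SpecificLimits.Basic
import HarnessLib

/-!
# Kesten's renewal lower bound: a Kraft inequality for irreducible bridges bounds `μ` from below

Topic `Literature/Probability/RandomPlanarGeometry` (continues `SAWWordBridges.lean`). The method
of Kesten (1963), Guttmann, Alm–Parviainen and Jensen (2004, §2) for LOWER bounds on the connective
constant: if `S` is a finite set of irreducible bridges (containing the one-step bridge) and
`Σ_{s ∈ S} ρ^{-|s|} ≥ 1`, then `ρ ≤ μ`. Proof: by unique decoding (`eq_of_append_eq`) the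
concatenations of sequences from `S` of total length `n` are `d_n` DISTINCT bridges, where
`d_n ≥ Σ_{s ∈ S} d_{n-|s|}`; hence `d_n ≥ κ ρⁿ` for some `κ > 0`, while `d_n ≤ b_n ≤ μⁿ`
(`Zd.bridgeCount_le_pow`, Madras–Slade (1.2.17)).

## Contents (namespace `Literature.Probability.RandomPlanarGeometry.SAW.Renewal`)

* `IsSeq S w` (`w` is a concatenation of elements of `S`), `seqWords S n`, `dseq S n = d_n`;
* `Admissible S` (all elements are irreducible bridges); `dseq_le_bridgeCount`, `sum_dseq_le`
  (the renewal inequality), `exists_mul_pow_le_dseq` (`κ ρⁿ ≤ d_n`);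
* **`le_connectiveConstant_of_kraft`**: `Admissible S → [+e₀] ∈ S → 1 ≤ Σ_{s∈S} ρ^{-|s|} → ρ ≤ μ(ℤ²)`.

## References

* H. Kesten, *On the number of self-avoiding walks*, J. Math. Phys. 4 (1963) 960–969, §4.
* I. Jensen, *Improved lower bounds on the connective constants for two-dimensional self-avoiding
  walks*, J. Phys. A 37 (2004) 11521–11529, §2, eq. (3)–(4).
* N. Madras, G. Slade, *The Self-Avoiding Walk* (1993), §1.2, (1.2.17); §4.2.
-/

open Finset Filter Topology Literature.Probability.LatticeModels
open scoped BigOperators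

namespace Literature.Probability.RandomPlanarGeometry.SAW

namespace Renewal

variable (S : Finset (List Step))

/-! ### Concatenations of sequences from `S` -/

/-- `w` is a concatenation of a finite sequence of elements of `S`. [cite: Kesten1963SAW, §4] -/
def IsSeq (w : List Step) : Prop := ∃ L : List (List Step), (∀ s ∈ L, s ∈ S) ∧ L.flatten = w

/-- The empty word is the empty concatenation. [folklore] -/
theorem isSeq_nil : IsSeq S [] := ⟨[], by simp, rfl⟩

variable {S}

/-- Prepending an element of `S`. [folklore] -/
theorem IsSeq.append_left {s w : List Step} (hs : s ∈ S) (h : IsSeq S w) : IsSeq S (s ++ w) := by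
  obtain ⟨L, hL, rfl⟩ := h
  exact ⟨s :: L, by simpa [or_imp, forall_and] using ⟨hs, hL⟩, by simp⟩

/-- **Admissible** sets of blocks: every element is an irreducible bridge (a predicate on finite
sets of step words, not a result). [cite: Kesten1963SAW, §4] -/
def Admissible (S : Finset (List Step)) : Prop := ∀ s ∈ S, IsIrrBridge s

/-- The one-step bridge `[+e₀]` is an irreducible bridge, so admissible sets containing it exist
(e.g. `{[+e₀]}`). [cite: MadrasSlade1993, §4.2, Definition 4.2.1] -/
theorem isIrrBridge_single : IsIrrBridge [(0 : Step)] := by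
  refine ⟨by decide, ?_, ?_, by simp⟩
  · rw [isBridgeW_iff]
    intro i h1 h2
    simp only [List.length_singleton] at h2
    obtain rfl : i = 1 := by omega
    simp [xEnd, xAt, traj, Step.vec, Step.dx]
  · rintro j ⟨h0, hjl, -, -⟩
    simp at hjl; omega

/-- A concatenation of irreducible bridges is a self-avoiding bridge. [cite: MadrasSlade1993, §1.2, eq. (1.2.15)] -/
theorem IsSeq.bridge_saw (hS : Admissible S) {w : List Step} (h : IsSeq S w) :
    IsBridgeW w ∧ IsSAW w := by
  obtain ⟨L, hL, rfl⟩ := h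
  induction L with
  | nil => exact ⟨isBridgeW_nil, isSAW_nil⟩
  | cons s L ih =>
    have hs : IsIrrBridge s := hS s (hL s (by simp))
    obtain ⟨hb, hw⟩ := ih fun s' hs' => hL s' (by simp [hs'])
    rw [List.flatten_cons]
    exact ⟨hs.bridge.append hb, hs.saw.append_of_bridge hw hs.bridge hb⟩

variable (S)

open Classical in
/-- The concatenations from `S` of total length `n`. [cite: Kesten1963SAW, §4] -/
noncomputable def seqWords (n : ℕ) : Finset (List Step) := (words n).filter (IsSeq S)

/-- `d_n`, the number of concatenations from `S` of total length `n`. [cite: Jensen2004SAWLowerBounds, §2] -/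
noncomputable def dseq (n : ℕ) : ℕ := (seqWords S n).card

variable {S}

/-- Membership in `seqWords`. [folklore] -/
@[simp] theorem mem_seqWords {n : ℕ} {w : List Step} : w ∈ seqWords S n ↔ w.length = n ∧ IsSeq S w := by
  classical
  simp [seqWords]

/-- If the one-step bridge `[+e₀]` is in `S` then `d_n ≥ 1` (the straight walk). [folklore] -/
theorem one_le_dseq (hE : [(0 : Step)] ∈ S) (n : ℕ) : 1 ≤ dseq S n := by
  refine card_pos.2 ⟨List.replicate n (0 : Step), mem_seqWords.2 ⟨by simp, ?_⟩⟩
  refine ⟨List.replicate n [(0 : Step)], fun s hs => ?_, ?_⟩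
  · rw [List.eq_of_mem_replicate hs]; exact hE
  · induction n with
    | zero => rfl
    | succ n ih => simp [List.replicate_succ, ih]

/-- `d_n ≤ b_n`: distinct words give distinct bridges. [cite: MadrasSlade1993, §1.2] -/
theorem dseq_le_bridgeCount (hS : Admissible S) (n : ℕ) : dseq S n ≤ Zd.bridgeCount 2 n := by
  classical
  rw [dseq, Zd.bridgeCount]
  have himg : (seqWords S n).image traj ⊆ Zd.bridges 2 n := by
    intro ω hω
    obtain ⟨w, hw, rfl⟩ := mem_image.1 hω
    obtain ⟨hl, hseq⟩ := mem_seqWords.1 hw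
    obtain ⟨hb, hsaw⟩ := hseq.bridge_saw hS
    exact traj_mem_bridges hl hsaw hb
  refine le_trans ?_ (card_le_card himg)
  rw [card_image_of_injOn]
  intro w hw w' hw' h
  exact traj_injOn n (by simp [(mem_seqWords.1 hw).1]) (by simp [(mem_seqWords.1 hw').1]) h

/-- **The renewal inequality** `Σ_{s ∈ S, |s| ≤ n} d_{n-|s|} ≤ d_n`: prefixing the concatenations
of length `n - |s|` by `s` gives concatenations of length `n`, disjointly in `s` by unique
decoding. [cite: Jensen2004SAWLowerBounds, §2, eq. (3)] -/
theorem sum_dseq_le (hS : Admissible S) (n : ℕ) :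
    ∑ s ∈ S.filter (fun s => s.length ≤ n), dseq S (n - s.length) ≤ dseq S n := by
  classical
  have hsub : (S.filter fun s => s.length ≤ n).biUnion
      (fun s => (seqWords S (n - s.length)).image (s ++ ·)) ⊆ seqWords S n := by
    intro w hw
    simp only [mem_biUnion, mem_filter, mem_image] at hw
    obtain ⟨s, ⟨hs, hsl⟩, t, ht, rfl⟩ := hw
    obtain ⟨htl, hts⟩ := mem_seqWords.1 ht
    exact mem_seqWords.2 ⟨by simp [htl]; omega, hts.append_left hs⟩
  refine le_trans (le_of_eq ?_) (card_le_card hsub)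
  rw [card_biUnion]
  · refine sum_congr rfl fun s _ => ?_
    rw [dseq, card_image_of_injective _ fun t t' h => List.append_cancel_left h]
  · intro s hs s' hs' hne
    simp only [Function.onFun]
    rw [Finset.disjoint_left]
    intro w hw hw'
    simp only [mem_image] at hw hw'
    obtain ⟨t, ht, rfl⟩ := hw
    obtain ⟨t', ht', h⟩ := hw'
    simp only [coe_filter, Set.mem_setOf_eq] at hs hs'
    have h1 := (mem_seqWords.1 ht).2.bridge_saw hS
    have h2 := (mem_seqWords.1 ht').2.bridge_saw hS
    exact hne (eq_of_append_eq (hS s hs.1) (hS s' hs'.1) h1.1 h2.1 h.symm)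

/-! ### Exponential growth from the Kraft inequality -/

/-- **`κ ρⁿ ≤ d_n`** for some `κ > 0`, if `Σ_{s∈S} ρ^{-|s|} ≥ 1` and `[+e₀] ∈ S`.
[cite: Jensen2004SAWLowerBounds, §2, eq. (3)–(4)] -/
theorem exists_mul_pow_le_dseq (hS : Admissible S) (hE : [(0 : Step)] ∈ S) {ρ : ℝ} (hρ : 0 < ρ)
    (hK : 1 ≤ ∑ s ∈ S, ρ⁻¹ ^ s.length) :
    ∃ κ : ℝ, 0 < κ ∧ ∀ n, κ * ρ ^ n ≤ dseq S n := by
  set N₀ := S.sup List.length with hN₀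
  have hlen : ∀ s ∈ S, s.length ≤ N₀ := fun s hs => Finset.le_sup (f := List.length) hs
  -- κ = min_{m ≤ N₀} d_m / ρ^m > 0
  have hne : (Finset.range (N₀ + 1)).Nonempty := ⟨0, by simp⟩
  set κ := (Finset.range (N₀ + 1)).inf' hne (fun m => (dseq S m : ℝ) / ρ ^ m) with hκ
  have hκpos : 0 < κ := by
    rw [hκ, Finset.lt_inf'_iff]
    intro m _
    have := one_le_dseq hE m
    positivity
  have hκle : ∀ m ≤ N₀, κ * ρ ^ m ≤ dseq S m := by
    intro m hm
    have h1 : κ ≤ (dseq S m : ℝ) / ρ ^ m := Finset.inf'_le _ (by simp; omega)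
    rwa [le_div_iff₀ (pow_pos hρ m)] at h1
  refine ⟨κ, hκpos, fun n => ?_⟩
  induction n using Nat.strong_induction_on with
  | _ n ih =>
    rcases le_or_gt n N₀ with hn | hn
    · exact hκle n hn
    · -- renewal: d_n ≥ Σ_s d_{n-|s|} ≥ Σ_s κ ρ^{n-|s|} = κ ρⁿ Σ_s ρ^{-|s|} ≥ κ ρⁿ
      have hfil : S.filter (fun s => s.length ≤ n) = S := by
        ext s; simp only [mem_filter, and_iff_left_iff_imp]
        exact fun hs => (hlen s hs).trans hn.le
      have h1 := sum_dseq_le hS n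
      rw [hfil] at h1
      have h2 : ∀ s ∈ S, κ * ρ ^ n * ρ⁻¹ ^ s.length ≤ dseq S (n - s.length) := by
        intro s hs
        have hsn : s.length ≤ n := (hlen s hs).trans hn.le
        have hs1 : 1 ≤ s.length := List.length_pos_iff.2 (hS s hs).ne_nil
        have := ih (n - s.length) (by omega)
        calc κ * ρ ^ n * ρ⁻¹ ^ s.length = κ * ρ ^ (n - s.length) := by
              rw [inv_pow, mul_assoc, ← div_eq_mul_inv, pow_sub₀ _ hρ.ne' hsn, div_eq_mul_inv]
          _ ≤ dseq S (n - s.length) := this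
      calc κ * ρ ^ n ≤ κ * ρ ^ n * ∑ s ∈ S, ρ⁻¹ ^ s.length := by
            have : 0 ≤ κ * ρ ^ n := by positivity
            nlinarith
        _ = ∑ s ∈ S, κ * ρ ^ n * ρ⁻¹ ^ s.length := by rw [mul_sum]
        _ ≤ ∑ s ∈ S, (dseq S (n - s.length) : ℝ) := sum_le_sum h2
        _ ≤ dseq S n := by exact_mod_cast h1

/-- **Kesten's renewal lower bound.** If `S` is a finite set of irreducible bridges containing the
one-step bridge and `Σ_{s ∈ S} ρ^{-|s|} ≥ 1`, then `ρ ≤ μ(ℤ²)`: indeed `κ ρⁿ ≤ d_n ≤ b_n ≤ μⁿ` for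
all `n`. The hypothesis `[+e₀] ∈ S` is a CONVENIENCE restriction of this formalisation (it makes
every `d_n ≥ 1`); Kesten/Jensen instead obtain `d_n > 0` along a subsequence. It costs nothing in
applications (the one-step bridge is always available, `isIrrBridge_single`).
[cite: Jensen2004SAWLowerBounds, §2, eq. (3)–(4)] -/
theorem le_connectiveConstant_of_kraft (hS : Admissible S) (hE : [(0 : Step)] ∈ S) {ρ : ℝ}
    (hρ : 0 < ρ) (hK : 1 ≤ ∑ s ∈ S, ρ⁻¹ ^ s.length) : ρ ≤ connectiveConstant := by
  obtain ⟨κ, hκ, hd⟩ := exists_mul_pow_le_dseq hS hE hρ hK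
  set μ := connectiveConstant with hμ
  have hμpos : 0 < μ := by rw [hμ, ← Zd.connectiveConstant_two]; exact Zd.connectiveConstant_pos 2
  -- κ ρⁿ ≤ μⁿ for all n
  have hle : ∀ n : ℕ, κ * ρ ^ n ≤ μ ^ n := fun n =>
    calc κ * ρ ^ n ≤ dseq S n := hd n
      _ ≤ Zd.bridgeCount 2 n := by exact_mod_cast dseq_le_bridgeCount hS n
      _ ≤ μ ^ n := by rw [hμ, ← Zd.connectiveConstant_two]; exact Zd.bridgeCount_le_pow n
  by_contra hlt
  rw [not_le] at hlt
  have hq : μ / ρ < 1 := (div_lt_one hρ).2 hlt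
  have hq0 : 0 ≤ μ / ρ := by positivity
  have hlim := tendsto_pow_atTop_nhds_zero_of_lt_one hq0 hq
  have hκle : ∀ n : ℕ, κ ≤ (μ / ρ) ^ n := fun n => by
    rw [div_pow, le_div_iff₀ (pow_pos hρ n)]
    exact hle n
  have := ge_of_tendsto' hlim hκle
  linarith

end Renewal

end Literature.Probability.RandomPlanarGeometry.SAW
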